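import Literature.Geometry.Kaehler.LimitConeStructure
import Literature.Geometry.Kaehler.HolomorphicChain

/-!
# The tangent-cone chain: a holomorphic chain on the components of the limit cone

For a pure `p`-dimensional analytic set `A ⊆ Ω ⊆ V`, a point `b ∈ Ω` and an integer-valued
multiplicity function `d` on subsets of `⊤ : Opens V`, the holomorphic `p`-chain
`limitConeChain hA hb d` on all of `V` whose components are the irreducible conic pieces
`limitConeIrr A hb y` (`y ∈ limitConeReg A hb p`, `LimitConeStructure.lean`) of the limit cone
`F` of `A` at `b`, with multiplicities `d`. Its support is a union of cones, hence **invariant under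
all complex dilations `x ↦ c • x`** (`limitConeChain_smul_mem_support`) — the first property of the
tangent cone in King's theorem (`Literature.Geometry.Kaehler.King1971_tangentCone`).

Definitions with bodies + theorems; no named facts.

## References

* J. R. King, *The currents defined by analytic varieties*, Acta Math. 127 (1971), Thm. 5.1.1.
* R. Harvey, *Holomorphic chains and their boundaries*, PSPUM XXX.1 (1977), §1.10 [Harvey1977].
-/

open scoped Manifold Topology
open Set Filter Function TopologicalSpace Metric

namespace Literature.Geometry.Kaehler

universe u

variable {V : Type u} [NormedAddCommGroup V] [InnerProductSpace ℂ V] [FiniteDimensional ℂ V]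
  {Ω : Opens V} {A : Set Ω} {b : V} {p : ℕ}

/-- The set of conic components `cl C(y)`, `y ∈ M`, of the limit cone. [cite: Harvey1977, §1.10] -/
def limitConeComponents (A : Set Ω) (hb : b ∈ (Ω : Set V)) (p : ℕ) : Set (Set (⊤ : Opens V)) :=
  {Z | ∃ y ∈ limitConeReg A hb p, Z = limitConeIrr A hb y}

/-- There are finitely many conic components. [cite: Chirka1989, §5.1 Thm. (1)] -/
theorem finite_limitConeComponents (hA : IsAnalyticSet 𝓘(ℂ, V) A) (hb : b ∈ (Ω : Set V)) :
    (limitConeComponents A hb p).Finite := by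
  have h := (finite_setOf_limitConeComp (A := A) (hb := hb) (p := p) hA).image closure
  refine h.subset ?_
  rintro Z ⟨y, hy, rfl⟩
  exact ⟨limitConeComp A hb y, ⟨y, hy, rfl⟩, rfl⟩

/-- **The tangent-cone chain with multiplicities `d`**: the holomorphic `p`-chain on `V` whose
components are the conic pieces of the limit cone, with multiplicity `d Z` on the piece `Z` (and
`0` on every other set). [cite: Harvey1977, §1.10; King 1971, 5.1.1] -/
noncomputable def limitConeChain (hA : HasPureDim 𝓘(ℂ, V) A p) (hb : b ∈ (Ω : Set V)) (d : Set (⊤ : Opens V) → ℤ) :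
    HolomorphicChain 𝓘(ℂ, V) (⊤ : Opens V) p where
  mult Z := open scoped Classical in if Z ∈ limitConeComponents A hb p then d Z else 0
  isIrreducibleAnalyticSet_of_mult_ne_zero := by
    intro Z hZ
    classical
    by_cases h : Z ∈ limitConeComponents A hb p
    · obtain ⟨y, hy, rfl⟩ := h
      exact isIrreducibleAnalyticSet_limitConeIrr hA.isAnalyticSet hy
    · simp [h] at hZ
  hasPureDim_of_mult_ne_zero := by
    intro Z hZ
    classical
    by_cases h : Z ∈ limitConeComponents A hb p
    · obtain ⟨y, hy, rfl⟩ := h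
      exact hasPureDim_limitConeIrr hA hy
    · simp [h] at hZ
  finite_inter_compact := by
    intro K _
    classical
    refine (finite_limitConeComponents (p := p) hA.isAnalyticSet hb).subset ?_
    intro Z hZ
    by_contra h
    simp [h] at hZ

/-- The multiplicity of the tangent-cone chain on a conic component. [folklore] -/
theorem limitConeChain_mult_of_mem (hA : HasPureDim 𝓘(ℂ, V) A p) (hb : b ∈ (Ω : Set V))
    (d : Set (⊤ : Opens V) → ℤ) {Z : Set (⊤ : Opens V)} (hZ : Z ∈ limitConeComponents A hb p) :
    (limitConeChain hA hb d).mult Z = d Z := by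
  classical
  simp [limitConeChain, hZ]

/-- The multiplicity of the tangent-cone chain vanishes off the conic components. [folklore] -/
theorem limitConeChain_mult_of_not_mem (hA : HasPureDim 𝓘(ℂ, V) A p) (hb : b ∈ (Ω : Set V))
    (d : Set (⊤ : Opens V) → ℤ) {Z : Set (⊤ : Opens V)} (hZ : Z ∉ limitConeComponents A hb p) :
    (limitConeChain hA hb d).mult Z = 0 := by
  classical
  simp [limitConeChain, hZ]

/-- **The support of the tangent-cone chain**: the union of the conic components of nonzero
multiplicity. [folklore] -/
theorem mem_support_limitConeChain_iff (hA : HasPureDim 𝓘(ℂ, V) A p) (hb : b ∈ (Ω : Set V))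
    (d : Set (⊤ : Opens V) → ℤ) {x : (⊤ : Opens V)} :
    x ∈ (limitConeChain hA hb d).support ↔
      ∃ y ∈ limitConeReg A hb p, d (limitConeIrr A hb y) ≠ 0 ∧ x ∈ limitConeIrr A hb y := by
  classical
  rw [HolomorphicChain.mem_support_iff]
  constructor
  · rintro ⟨Z, hZ, hxZ⟩
    by_cases h : Z ∈ limitConeComponents A hb p
    · obtain ⟨y, hy, rfl⟩ := h
      rw [limitConeChain_mult_of_mem hA hb d ⟨y, hy, rfl⟩] at hZ
      exact ⟨y, hy, hZ, hxZ⟩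
    · exact absurd (limitConeChain_mult_of_not_mem hA hb d h) hZ
  · rintro ⟨y, hy, hd, hx⟩
    exact ⟨limitConeIrr A hb y, by rwa [limitConeChain_mult_of_mem hA hb d ⟨y, hy, rfl⟩], hx⟩

/-- The support of the tangent-cone chain lies in the limit cone. [folklore] -/
theorem support_limitConeChain_subset (hA : HasPureDim 𝓘(ℂ, V) A p) (hb : b ∈ (Ω : Set V))
    (d : Set (⊤ : Opens V) → ℤ) : (limitConeChain hA hb d).support ⊆ limitConeTop A hb := by
  intro x hx
  obtain ⟨y, -, -, hxy⟩ := (mem_support_limitConeChain_iff hA hb d).1 hx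
  exact limitConeIrr_subset y hxy

/-- **The support of the tangent-cone chain is a complex cone**: invariant under `x ↦ c • x` for
every `c : ℂ` (for `c = 0` because every conic component contains the vertex).
[cite: Harvey1977, §1.10; King 1971, 5.1.1] -/
theorem limitConeChain_smul_mem_support (hA : HasPureDim 𝓘(ℂ, V) A p) (hb : b ∈ (Ω : Set V))
    (d : Set (⊤ : Opens V) → ℤ) {x : (⊤ : Opens V)} (hx : x ∈ (limitConeChain hA hb d).support)
    (c : ℂ) : (⟨c • (x : V), trivial⟩ : (⊤ : Opens V)) ∈ (limitConeChain hA hb d).support := by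
  rw [mem_support_limitConeChain_iff] at hx ⊢
  obtain ⟨y, hy, hd, hxy⟩ := hx
  refine ⟨y, hy, hd, ?_⟩
  by_cases hc : c = 0
  · subst hc
    have h0 := zero_mem_limitConeIrr (A := A) (hb := hb) hy
    simpa using h0
  · exact topSmul_mem_limitConeIrr hxy hc

end Literature.Geometry.Kaehler
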